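import Mathlib
import Summits.MatrixMultiplication.MatrixMultiplication.Theses.FourierTwoFamiliesModP
import Literature.Computability.AlgebraicComplexity.SimultaneousDoubleProduct
import Summits.MatrixMultiplication.MatrixMultiplication.Theorems.FourierTwoFamiliesModPPrimeTwoFamiliesLadderConverse
import Summits.MatrixMultiplication.MatrixMultiplication.Theorems.FourierTwoFamiliesModPPrimeTwoFamiliesCapacityEquivalences

/-!
# Stub `stub_honestOfSelfConverse` of crux `PrimeTwoFamilies` (stmt-MatrixMultiplication-14308), line `Sketch` —
# by reduction to the landed lemmas of the crux (assembly variant)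

Self-converse gadgets contain honest designs.  This file proves the registered stub signature verbatim,
but ASSEMBLES it from what the line has already landed instead of re-doing the popular-point argument:

* `CapacityLift.selfConverseGadgets_iff_primeTwoFamilies` (Theorems/…CapacityEquivalences): the L = 2
  self-converse gadget statement is equivalent to the crux `FourierTwoFamiliesModP.PrimeTwoFamilies`
  (⇒ graph words are a zero-error code, code lift, carry-free transfer, bookkeeping);
* `LadderLift.ladder_exponents` (Theorems/…LadderConverse): for `0 < δ ≤ ε`, `δ ≤ 1`, `1 ≤ p`, `1 ≤ n`,
  `p ≤ n^{2+δ}` one has `p^{1/2-ε} ≤ n` and `p^{1-ε} ≤ n^{2-δ}`;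
* `card_mul_card_le_of_dpp` (Literature, CKSU Prop. 4.6): a direct pair in `ℤ/p` has `|A||B| ≤ p`.

So a slice-`δ` witness of the crux (`δ = min ε 1`, `n ≥ m₀ + 2` pairs in `ℤ/p`, `p ≤ n^{2+δ}`,
co-volumes `≥ n^{2-δ}`) is itself the honest family asked for, in the SAME `ℤ/p` (`m := p`):
clauses (W), (X) are untouched, `p^{1/2-ε} ≤ n`, `p^{1-ε} ≤ n^{2-δ} ≤ |A i||B i|`, and
`m₀ ≤ n ≤ n^{2-δ} ≤ |A 0||B 0| ≤ p`.

Helper file landed `--supports stmt-MatrixMultiplication-14308`; no new definitions.  It lives in its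
own sub-namespace `…CapacityLift.HonestAssembly` so that it does not collide with the direct proof of
the same stub in `Theorems/FourierTwoFamiliesModPPrimeTwoFamiliesStubHonestOfSelfConverse.lean`.
-/

-- single-conjunct summit: the mandated namespace repeats `MatrixMultiplication`.
set_option linter.dupNamespace false

namespace Summit.MatrixMultiplication.MatrixMultiplication.Theorems.PrimeTwoFamilies.CapacityLift.HonestAssembly

open Finset
open Summit.MatrixMultiplication.MatrixMultiplication.Theses
open Summit.MatrixMultiplication.MatrixMultiplication.Theorems
open Summit.MatrixMultiplication.MatrixMultiplication.Theorems.PrimeTwoFamilies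
open Literature.Computability.AlgebraicComplexity

/-- **Honest families from the crux** (the assembly step): `PrimeTwoFamilies` gives, for every `ε > 0`
and `m₀`, some `m ≥ m₀` (a prime) and an honest SDPP family `(A i, B i)_{i<n}` in `ZMod m` — clauses
(W) and (X) verbatim — with `m^{1/2-ε} ≤ n` pairs of co-volume `m^{1-ε} ≤ |A i||B i|`.
Proof: the slice `δ = min ε 1` witness at `n₀ = m₀ + 2` in `ℤ/p`, `m := p`; exponents by
`LadderLift.ladder_exponents`, and `m₀ ≤ p` from `n ≤ n^{2-δ} ≤ |A 0||B 0| ≤ p`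
(`card_mul_card_le_of_dpp`). -/
theorem honest_of_primeTwoFamilies (hT : FourierTwoFamiliesModP.PrimeTwoFamilies) :
    ∀ ε : ℝ, 0 < ε → ∀ m₀ : ℕ, ∃ m ≥ m₀, ∃ n : ℕ, ∃ A B : Fin n → Finset (ZMod m),
      (∀ i : Fin n, ∀ a ∈ A i, ∀ a' ∈ A i, ∀ b ∈ B i, ∀ b' ∈ B i,
          (a - a') + (b - b') = 0 → a = a' ∧ b = b') ∧
      (∀ i j k : Fin n, ∀ a ∈ A i, ∀ a' ∈ A j, ∀ b ∈ B j, ∀ b' ∈ B k,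
          (a - a') + (b - b') = 0 → i = k) ∧
      (m : ℝ) ^ (1 / 2 - ε) ≤ (n : ℝ) ∧
      ∀ i : Fin n, (m : ℝ) ^ (1 - ε) ≤ (((A i).card * (B i).card : ℕ) : ℝ) := by
  intro ε hε m₀
  set δ : ℝ := min ε 1 with hδdef
  have hδ : 0 < δ := lt_min hε one_pos
  have hδε : δ ≤ ε := min_le_left _ _
  have hδ1 : δ ≤ 1 := min_le_right _ _
  obtain ⟨n, hn, p, hp, A, B, hW, hX, hpn, hAB⟩ := hT δ hδ (m₀ + 2)
  haveI : Fact p.Prime := ⟨hp⟩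
  have hn1 : 1 ≤ n := by omega
  have hn1' : (1 : ℝ) ≤ n := by exact_mod_cast hn1
  -- `m₀ ≤ p`: `m₀ + 2 ≤ n ≤ n^{2-δ} ≤ |A i₀||B i₀| ≤ p`
  have i₀ : Fin n := ⟨0, by omega⟩
  have hABp : (A i₀).card * (B i₀).card ≤ p := by
    have := card_mul_card_le_of_dpp (H := ZMod p) (hW i₀)
    rwa [ZMod.card] at this
  have hm₀ : m₀ ≤ p := by
    have h1 : (n : ℝ) ≤ (n : ℝ) ^ (2 - δ) := by
      calc (n : ℝ) = (n : ℝ) ^ (1 : ℝ) := (Real.rpow_one _).symm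
        _ ≤ (n : ℝ) ^ (2 - δ) := Real.rpow_le_rpow_of_exponent_le hn1' (by linarith)
    have h2 : (n : ℝ) ≤ (p : ℝ) := (h1.trans (hAB i₀)).trans (by exact_mod_cast hABp)
    have h3 : n ≤ p := by exact_mod_cast h2
    omega
  obtain ⟨hr, hcov⟩ := LadderLift.ladder_exponents hδ hδε hδ1 hp.one_lt.le hn1 hpn
  exact ⟨p, hm₀, n, A, B, hW, hX, hr, fun i => hcov.trans (hAB i)⟩

/-- **Self-converse gadgets contain honest designs** (registered stub `stub_honestOfSelfConverse` of line
`Sketch`, crux stmt-MatrixMultiplication-14308), assembled from the landed lemmas of the crux: if for every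
`ε > 0` there are arbitrarily large `m`, a gadget of `r ≥ m^{1-ε}` direct pairs `(P c, Q c)` in `ℤ/m` of
co-volume `|P c||Q c| ≥ m^{1-ε}`, and a map `π` under which every ordered pair of distinct letters is
strongly separated directly or after `π`, then for every `ε > 0` there are arbitrarily large `m` and an
HONEST SDPP family ((W) ∧ (X) verbatim) in `ℤ/m` with `n ≥ m^{1/2-ε}` pairs of co-volume `≥ m^{1-ε}`.
Proof: the hypothesis is the crux (`CapacityLift.selfConverseGadgets_iff_primeTwoFamilies`, landed), and
the crux's own slice witnesses are such honest families (`honest_of_primeTwoFamilies`). -/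
theorem stub_honestOfSelfConverse
    (h : ∀ ε : ℝ, 0 < ε → ∀ m₀ : ℕ, ∃ m ≥ m₀, ∃ r : ℕ, ∃ P Q : Fin r → Finset (ZMod m),
      ∃ π : Fin r → Fin r,
        (∀ c : Fin r, ∀ x ∈ P c, ∀ x' ∈ P c, ∀ y ∈ Q c, ∀ y' ∈ Q c,
            (x - x') + (y - y') = 0 → x = x' ∧ y = y') ∧
        (∀ σ τ : Fin r, σ ≠ τ →
            (∀ x ∈ P σ, ∀ y ∈ Q τ, ∀ c : Fin r, ∀ x' ∈ P c, ∀ y' ∈ Q c, y - x ≠ y' - x') ∨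
            (∀ x ∈ P (π σ), ∀ y ∈ Q (π τ), ∀ c : Fin r, ∀ x' ∈ P c, ∀ y' ∈ Q c, y - x ≠ y' - x')) ∧
        (m : ℝ) ^ (1 - ε) ≤ (r : ℝ) ∧
        ∀ c : Fin r, (m : ℝ) ^ (1 - ε) ≤ (((P c).card * (Q c).card : ℕ) : ℝ)) :
    ∀ ε : ℝ, 0 < ε → ∀ m₀ : ℕ, ∃ m ≥ m₀, ∃ n : ℕ, ∃ A B : Fin n → Finset (ZMod m),
      (∀ i : Fin n, ∀ a ∈ A i, ∀ a' ∈ A i, ∀ b ∈ B i, ∀ b' ∈ B i,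
          (a - a') + (b - b') = 0 → a = a' ∧ b = b') ∧
      (∀ i j k : Fin n, ∀ a ∈ A i, ∀ a' ∈ A j, ∀ b ∈ B j, ∀ b' ∈ B k,
          (a - a') + (b - b') = 0 → i = k) ∧
      (m : ℝ) ^ (1 / 2 - ε) ≤ (n : ℝ) ∧
      ∀ i : Fin n, (m : ℝ) ^ (1 - ε) ≤ (((A i).card * (B i).card : ℕ) : ℝ) :=
  honest_of_primeTwoFamilies (CapacityLift.selfConverseGadgets_iff_primeTwoFamilies.1 h)

end Summit.MatrixMultiplication.MatrixMultiplication.Theorems.PrimeTwoFamilies.CapacityLift.HonestAssembly
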